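import Mathlib
import Summits.FinalStateConjecture.FinalStateConjecture.Theorems.EternalPapapetrouSchwarzschildExteriorModeRigidityCore
import Summits.FinalStateConjecture.FinalStateConjecture.Theorems.EternalPapapetrouSchwarzschildExteriorModeRigidityJets
import HarnessLib

/-!
# Route EternalPapapetrou · SchwarzschildExteriorModeRigidity — the characteristic fields of a jet

Helper file for item stmt-FinalStateConjecture-10039 (`SchwarzschildExteriorModeRigidity`).

For a jet `J` of the reduced system over `E = ι → ℝ` we define the radiation field `G = ρ V`,
its null derivatives `P = (1 − 2M/ρ)(V + ρ V_r − ρ V_t)`, `Q = (1 − 2M/ρ)(V + ρ V_r + ρ c V_t)`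
(`c = (ρ + 2M)/(ρ − 2M)` the slope of the outgoing characteristics `t = u + ρ + 4M log(ρ − 2M)`
of the ingoing Eddington–Finkelstein chart), the source `F = (2M/ρ²) V − ρ⁻¹ Λ V`, and verify
the transport identities along the two families of null characteristics which feed the abstract
transport–Grönwall lemma `core_eq_zero`. The algebra is done componentwise. [folklore]
-/

set_option linter.dupNamespace false

noncomputable section

namespace Summit.FinalStateConjecture.FinalStateConjecture.Theorems

open MeasureTheory Set Filter Topology Metric

namespace EternalPapapetrou.ModeRigidity

namespace RWJet

variable {ι : Type*} [Fintype ι] {M : ℝ} {Λ : (ι → ℝ) →L[ℝ] (ι → ℝ)}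

/-- The lapse-type factor `a ρ = 1 − 2M/ρ`. [folklore] -/
def aF (M ρ : ℝ) : ℝ := 1 - 2 * M * ρ⁻¹

/-- The slope `c ρ = 1 + 4M/(ρ − 2M) = (ρ + 2M)/(ρ − 2M)` of the outgoing null characteristics in
the `(t*, r)` chart. [folklore] -/
def cF (M ρ : ℝ) : ℝ := 1 + 4 * M * (ρ - 2 * M)⁻¹

/-- The outgoing characteristic time shift `cout ρ = ρ + 4M log(ρ − 2M)`. [folklore] -/
def coutF (M ρ : ℝ) : ℝ := ρ + 4 * M * Real.log (ρ - 2 * M)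

/-- The radiation field `G = ρ V`. [folklore] -/
def G (J : RWJet M Λ) (t ρ : ℝ) : ι → ℝ := ρ • J.V (t, ρ)

/-- `Gt = ρ V_t`. [folklore] -/
def Gt (J : RWJet M Λ) (t ρ : ℝ) : ι → ℝ := ρ • J.Vt (t, ρ)

/-- The outgoing null derivative `P = a (V + ρ V_r − ρ V_t)` of `G`. [folklore] -/
def P (J : RWJet M Λ) (t ρ : ℝ) : ι → ℝ :=
  aF M ρ • (J.V (t, ρ) + ρ • J.Vr (t, ρ) - ρ • J.Vt (t, ρ))

/-- The ingoing null derivative `Q = a (V + ρ V_r + ρ c V_t)` of `G`. [folklore] -/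
def Q (J : RWJet M Λ) (t ρ : ℝ) : ι → ℝ :=
  aF M ρ • (J.V (t, ρ) + ρ • J.Vr (t, ρ) + (ρ * cF M ρ) • J.Vt (t, ρ))

/-- The source `F = (2M/ρ²) V − ρ⁻¹ Λ V`. [folklore] -/
def F (J : RWJet M Λ) (t ρ : ℝ) : ι → ℝ :=
  (2 * M * (ρ⁻¹) ^ 2) • J.V (t, ρ) - ρ⁻¹ • Λ (J.V (t, ρ))

/-! ### Elementary facts -/

omit [Fintype ι] in
/-- The derivative of `a`. [folklore] -/
theorem hasDerivAt_aF {ρ : ℝ} (hρ : ρ ≠ 0) : HasDerivAt (aF M) (2 * M * (ρ⁻¹) ^ 2) ρ := by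
  unfold aF
  have := ((hasDerivAt_inv hρ).const_mul (2 * M)).const_sub 1
  refine this.congr_deriv ?_
  rw [inv_pow]; ring

omit [Fintype ι] in
/-- The derivative of `cout` is `c`. [folklore] -/
theorem hasDerivAt_coutF {ρ : ℝ} (hρ : 2 * M < ρ) : HasDerivAt (coutF M) (cF M ρ) ρ := by
  unfold coutF cF
  have h1 : HasDerivAt (fun ρ ↦ Real.log (ρ - 2 * M)) ((ρ - 2 * M)⁻¹ * 1) ρ :=
    (Real.hasDerivAt_log (by linarith)).comp ρ ((hasDerivAt_id ρ).sub_const _)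
  have := (hasDerivAt_id ρ).add (h1.const_mul (4 * M))
  refine this.congr_deriv ?_
  simp

omit [Fintype ι] in
/-- `cout` is continuous on `ρ > 2M`. [folklore] -/
theorem continuousOn_coutF : ContinuousOn (coutF M) (Ioi (2 * M)) := fun _ hρ ↦
  (hasDerivAt_coutF hρ).continuousAt.continuousWithinAt

/-- Differentiation along a curve `ρ ↦ (g ρ, ρ)` of a function with derivative `L₁ A B`.
[folklore] -/
theorem hasDerivAt_along {Φ : ℝ × ℝ → ι → ℝ} {A B : ι → ℝ} {g : ℝ → ℝ} {g' ρ : ℝ}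
    (hΦ : HasFDerivAt Φ (L₁ A B) (g ρ, ρ)) (hg : HasDerivAt g g' ρ) :
    HasDerivAt (fun ρ ↦ Φ (g ρ, ρ)) (g' • A + B) ρ := by
  have hγ : HasDerivAt (fun ρ ↦ ((g ρ, ρ) : ℝ × ℝ)) (g', 1) ρ := hg.prodMk (hasDerivAt_id ρ)
  have := HasFDerivAt.comp_hasDerivAt (f := fun ρ ↦ ((g ρ, ρ) : ℝ × ℝ)) ρ hΦ hγ
  simpa [Function.comp_def, L₁_apply] using this

/-! ### The transport identities -/

/-- **Outgoing transport**: along `ρ ↦ (u + cout ρ, ρ)`, `P` has derivative `F`. [folklore] -/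
theorem hasDerivAt_P (J : RWJet M Λ) (hM : 0 < M) (u : ℝ) {ρ : ℝ} (hρ : ρ ∈ Ioi (2 * M)) :
    HasDerivAt (fun ρ ↦ J.P (u + coutF M ρ) ρ) (J.F (u + coutF M ρ) ρ) ρ := by
  have hρ2 : 2 * M < ρ := hρ
  have hρ0 : ρ ≠ 0 := by intro h; rw [h] at hρ2; linarith
  have hρm : ρ - 2 * M ≠ 0 := by intro h; linarith
  have hp : ((u + coutF M ρ, ρ) : ℝ × ℝ) ∈ strip M := ⟨mem_univ _, hρ⟩
  have hg : HasDerivAt (fun ρ ↦ u + coutF M ρ) (cF M ρ) ρ := by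
    simpa using (hasDerivAt_coutF hρ2).const_add u
  have hV := hasDerivAt_along (J.hasFDerivAt _ hp) hg
  have hVt := hasDerivAt_along (J.hasFDerivAt_t _ hp) hg
  have hVr := hasDerivAt_along (J.hasFDerivAt_r _ hp) hg
  have hinner := (hV.add ((hasDerivAt_id ρ).smul hVr)).sub ((hasDerivAt_id ρ).smul hVt)
  have hall := (hasDerivAt_aF (M := M) hρ0).smul hinner
  refine (hall.congr_deriv ?_ : HasDerivAt (fun ρ ↦ J.P (u + coutF M ρ) ρ) _ ρ)
  -- the algebra, componentwise
  set p : ℝ × ℝ := (u + coutF M ρ, ρ) with hpdef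
  have hpde := J.pde p hp
  funext i
  have hi := congrFun hpde i
  simp only [rwOp, Pi.add_apply, Pi.smul_apply, smul_eq_mul, Pi.zero_apply, div_eq_mul_inv,
    hpdef] at hi
  have hy : ρ * ρ⁻¹ = 1 := mul_inv_cancel₀ hρ0
  have hz : (ρ - 2 * M) * (ρ - 2 * M)⁻¹ = 1 := mul_inv_cancel₀ hρm
  simp only [F, aF, cF, Pi.add_apply, Pi.sub_apply, Pi.smul_apply, Pi.smul_apply', smul_eq_mul,
    id_eq, hpdef]
  linear_combination ρ * hi +
    (-ρ⁻¹ * (Λ (J.V p)) i + (4 * M * ρ⁻¹ - 2) * J.Vr p i - 4 * M * ((ρ - 2 * M)⁻¹ + ρ⁻¹) * J.Vt p i +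
      4 * M * ρ * (ρ - 2 * M)⁻¹ * J.Vtt p i - 4 * M * ρ * (ρ - 2 * M)⁻¹ * J.Vtr p i) * hy +
    (4 * M * ρ⁻¹ * J.Vt p i - 4 * M * ρ * ρ⁻¹ * J.Vtt p i + 4 * M * ρ * ρ⁻¹ * J.Vtr p i) * hz

/-- **Ingoing transport**: along `ρ ↦ (u − ρ, ρ)`, `Q` has derivative `F`. [folklore] -/
theorem hasDerivAt_Q (J : RWJet M Λ) (hM : 0 < M) (u : ℝ) {ρ : ℝ} (hρ : ρ ∈ Ioi (2 * M)) :
    HasDerivAt (fun ρ ↦ J.Q (u - ρ) ρ) (J.F (u - ρ) ρ) ρ := by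
  have hρ2 : 2 * M < ρ := hρ
  have hρ0 : ρ ≠ 0 := by intro h; rw [h] at hρ2; linarith
  have hρm : ρ - 2 * M ≠ 0 := by intro h; linarith
  have hp : ((u - ρ, ρ) : ℝ × ℝ) ∈ strip M := ⟨mem_univ _, hρ⟩
  have hg : HasDerivAt (fun ρ ↦ u - ρ) (-1) ρ := by simpa using (hasDerivAt_id ρ).const_sub u
  have hV := hasDerivAt_along (J.hasFDerivAt _ hp) hg
  have hVt := hasDerivAt_along (J.hasFDerivAt_t _ hp) hg
  have hVr := hasDerivAt_along (J.hasFDerivAt_r _ hp) hg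
  have hc : HasDerivAt (fun ρ ↦ ρ * cF M ρ)
      (1 * cF M ρ + ρ * (-(4 * M) * ((ρ - 2 * M)⁻¹ * (ρ - 2 * M)⁻¹))) ρ := by
    have h1 : HasDerivAt (cF M) (-(4 * M) * ((ρ - 2 * M)⁻¹ * (ρ - 2 * M)⁻¹)) ρ := by
      unfold cF
      have := ((hasDerivAt_id ρ).sub_const (2 * M)).inv hρm
      have h2 := (this.const_mul (4 * M)).const_add 1
      refine (h2.congr_deriv ?_ : HasDerivAt (fun ρ ↦ 1 + 4 * M * (ρ - 2 * M)⁻¹) _ ρ)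
      simp only [id_eq]
      field_simp
    exact (hasDerivAt_id ρ).mul h1
  have hinner := (hV.add ((hasDerivAt_id ρ).smul hVr)).add (hc.smul hVt)
  have hall := (hasDerivAt_aF (M := M) hρ0).smul hinner
  refine (hall.congr_deriv ?_ : HasDerivAt (fun ρ ↦ J.Q (u - ρ) ρ) _ ρ)
  set p : ℝ × ℝ := (u - ρ, ρ) with hpdef
  have hpde := J.pde p hp
  funext i
  have hi := congrFun hpde i
  simp only [rwOp, Pi.add_apply, Pi.smul_apply, smul_eq_mul, Pi.zero_apply, div_eq_mul_inv,
    hpdef] at hi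
  have hy : ρ * ρ⁻¹ = 1 := mul_inv_cancel₀ hρ0
  have hz : (ρ - 2 * M) * (ρ - 2 * M)⁻¹ = 1 := mul_inv_cancel₀ hρm
  simp only [F, aF, cF, Pi.add_apply, Pi.sub_apply, Pi.smul_apply, Pi.smul_apply', smul_eq_mul,
    id_eq, hpdef]
  linear_combination ρ * hi +
    (-ρ⁻¹ * (Λ (J.V p)) i + (4 * M * ρ⁻¹ - 2) * J.Vr p i +
      4 * M * ρ * (ρ - 2 * M)⁻¹ * J.Vtt p i - 4 * M * ρ * (ρ - 2 * M)⁻¹ * J.Vtr p i +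
      8 * M ^ 2 * (ρ - 2 * M)⁻¹ * (ρ⁻¹ + (ρ - 2 * M)⁻¹) * J.Vt p i) * hy +
    (-4 * M * ρ * ρ⁻¹ * J.Vtt p i + 4 * M * ρ * ρ⁻¹ * J.Vtr p i - 4 * M * (ρ - 2 * M)⁻¹ * J.Vt p i) *
      hz

/-- Along the outgoing curves, `G` has derivative `a⁻¹ Q`. [folklore] -/
theorem hasDerivAt_G_out (J : RWJet M Λ) (u : ℝ) {ρ : ℝ} (hρ : ρ ∈ Ioi (2 * M)) (hM : 0 < M) :
    HasDerivAt (fun ρ ↦ J.G (u + coutF M ρ) ρ) ((aF M ρ)⁻¹ • J.Q (u + coutF M ρ) ρ) ρ := by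
  have hρ2 : 2 * M < ρ := hρ
  have hρ0 : 0 < ρ := by linarith
  have ha : aF M ρ ≠ 0 := by
    unfold aF
    have : 2 * M * ρ⁻¹ < 1 := by rw [← div_eq_mul_inv, div_lt_one hρ0]; exact hρ2
    linarith
  have hp : ((u + coutF M ρ, ρ) : ℝ × ℝ) ∈ strip M := ⟨mem_univ _, hρ⟩
  have hg : HasDerivAt (fun ρ ↦ u + coutF M ρ) (cF M ρ) ρ := by
    simpa using (hasDerivAt_coutF hρ2).const_add u
  have hV := hasDerivAt_along (J.hasFDerivAt _ hp) hg
  have hall := (hasDerivAt_id ρ).smul hV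
  refine (hall.congr_deriv ?_ : HasDerivAt (fun ρ ↦ J.G (u + coutF M ρ) ρ) _ ρ)
  simp only [Q, smul_add, smul_smul, inv_mul_cancel_left₀ ha, inv_mul_cancel₀ ha, one_smul, id_eq]
  module

/-- Along the ingoing curves, `G` has derivative `a⁻¹ P`. [folklore] -/
theorem hasDerivAt_G_in (J : RWJet M Λ) (u : ℝ) {ρ : ℝ} (hρ : ρ ∈ Ioi (2 * M)) (hM : 0 < M) :
    HasDerivAt (fun ρ ↦ J.G (u - ρ) ρ) ((aF M ρ)⁻¹ • J.P (u - ρ) ρ) ρ := by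
  have hρ2 : 2 * M < ρ := hρ
  have hρ0 : 0 < ρ := by linarith
  have ha : aF M ρ ≠ 0 := by
    unfold aF
    have : 2 * M * ρ⁻¹ < 1 := by rw [← div_eq_mul_inv, div_lt_one hρ0]; exact hρ2
    linarith
  have hp : ((u - ρ, ρ) : ℝ × ℝ) ∈ strip M := ⟨mem_univ _, hρ⟩
  have hg : HasDerivAt (fun ρ ↦ u - ρ) (-1) ρ := by simpa using (hasDerivAt_id ρ).const_sub u
  have hV := hasDerivAt_along (J.hasFDerivAt _ hp) hg
  have hall := (hasDerivAt_id ρ).smul hV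
  refine (hall.congr_deriv ?_ : HasDerivAt (fun ρ ↦ J.G (u - ρ) ρ) _ ρ)
  simp only [P, smul_add, smul_sub, smul_smul, inv_mul_cancel_left₀ ha, inv_mul_cancel₀ ha, one_smul,
    id_eq]
  module

/-- `Q − P = 2 Gt`. [folklore] -/
theorem Q_sub_P (J : RWJet M Λ) (hM : 0 < M) (t : ℝ) {ρ : ℝ} (hρ : ρ ∈ Ioi (2 * M)) :
    J.Q t ρ - J.P t ρ = (2 : ℝ) • J.Gt t ρ := by
  have hρ2 : 2 * M < ρ := hρ
  have hρ0 : ρ ≠ 0 := by intro h; rw [h] at hρ2; linarith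
  have hρm : ρ - 2 * M ≠ 0 := by intro h; linarith
  have hy : ρ * ρ⁻¹ = 1 := mul_inv_cancel₀ hρ0
  have hz : (ρ - 2 * M) * (ρ - 2 * M)⁻¹ = 1 := mul_inv_cancel₀ hρm
  funext i
  simp only [Q, P, Gt, aF, cF, Pi.add_apply, Pi.sub_apply, Pi.smul_apply, smul_eq_mul]
  linear_combination (4 * M * ρ * ρ⁻¹ * J.Vt (t, ρ) i) * hz -
    (4 * M * ρ * (ρ - 2 * M)⁻¹ * J.Vt (t, ρ) i) * hy

end RWJet

end EternalPapapetrou.ModeRigidity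

end Summit.FinalStateConjecture.FinalStateConjecture.Theorems
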